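import Literature.Analysis.FluidPDE.EyinkTransverseBalanceProofs
import HarnessLib

/-!
# Eyink's longitudinal balance `(uuL-eq)` at scale `ε`: discharge of `Torus.eyink_longitudinal_balance`

Topic: Analysis/FluidPDE, proofs. Sibling proof file of `EyinkBalance` (the named fact
`Torus.eyink_longitudinal_balance`: G. L. Eyink, *Local 4/5-law and energy dissipation anomaly in
turbulence*, Nonlinearity 16 (2003) 137–145 = arXiv:nlin/0208004, §2, proof of Thm. 1, (uuL-eq) — for
a distributional Euler solution `(u,p)` on `T^d × (0,T)`, `d ≥ 2`, `u ∈ L³`, `p ∈ L^{3/2}`, a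
spherically symmetric standard mollifier `φ`, `ε > 0` and a test function `ψ` supported in `(0,T)`,
`𝓔_L^{ε,φ}(ψ) = (4/d) ∫₀ᵀ∫ D_L^{ε,φ}(u) ψ`). This file PROVES it:

* `Torus.eyink_longitudinal_balance_holds : eyink_longitudinal_balance (d := d)`.

## Proof architecture

Eyink derives (uuL-eq) and (uuT-eq) by one and the same computation — Duchon–Robert's, run with the
matrix kernels `(ℓ̂⊗ℓ̂)φ^ε` resp. `(1 − ℓ̂⊗ℓ̂)φ^ε` in place of the scalar `φ^ε` — and records, in the
same proof, that the two decompositions are **exactly additive**: `u_L^ε + u_T^ε = u^ε`,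
`p_L^ε + p_T^ε = p^ε` (from `φ_L + φ_T = φ`, (phi-LT)), and `(4/3)D_L^ε + (8/3)D_T^ε = 4D_ε`
(the integrands of Thm. 1 add up to Duchon–Robert's `∇φ^ε·δu|δu|²`). Consequently, at every fixed
`ε > 0`, **(uuL-eq) = [Duchon–Robert's balance at scale `ε`] − (uuT-eq)**, term by term. The tree
already proves the two subtrahends:

1. *Duchon–Robert's balance at scale `ε`* for the smooth torus kernel `K_ε = periodize φ^ε`
   (`Torus.integral_kernelFlux_mul_eq_holds` — the cubic identity, `DuchonRobertCubicIdentity`;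
   `Torus.symmTestField_identity_holds` — the tested momentum equation,
   `DuchonRobertSymmTestFieldProofs`; the pressure split
   `Torus.integral_mul_divergence_symmTestField` and the unfolding
   `4D_ε = 𝒟_{K_ε}` (`Torus.four_mul_duchonRobertApprox_eq_kernelFlux`)): assembled here as
   `Torus.four_mul_integral_duchonRobertApprox_eq_sum`,
   `4∫∫D_εψ = A₁ − A₂ + 2A₃ + 2A₅ + 2E + 2F` (the six scalar pairings of `u ⋆ K_ε`, `|u|² ⋆ K_ε`,
   `(|u|²u) ⋆ K_ε`, `p ⋆ K_ε`).
2. *The transverse balance* `Torus.eyink_transverse_balance_holds` (`EyinkTransverseBalanceProofs`)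
   and its six-term split `Torus.eyinkBalanceT_eq_sum` (`EyinkBalanceOfMatrix`).
3. *The flux split* `∫∫D_εψ = d⁻¹∫∫D_L^{ε,φ}ψ + ((d−1)/d)∫∫D_T^{ε,φ}ψ` for radial unit-ball mollifiers
   (`Torus.integral_duchonRobertApprox_eq_longitudinal_add_transverse`; the polar formulas
   `Torus.integral_duchonRobertApprox_eq_radial`, `Torus.integral_eyinkApprox_eq` and Pythagoras on
   the sphere `Torus.energyFluxShellPairing_eq_add`, as inside
   `Torus.HasUniformEyinkDefect.tendsto_duchonRobertApprox` of `EyinkUniformDefectConsistency`).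

What is proved here in addition: the integrability of the six pieces of `𝓔_L^{ε,φ}(ψ)` on
`(0,T) × T^d` (`Torus.eyink_piecesL_integrable`, the Type I–IV integrability of `EyinkBalanceLimits`
with the longitudinal projection `P_L(ξ̂) = ξ̂⊗ξ̂`), the a.e. additivity of Eyink's objects
(`u_L^ε + u_T^ε = u ⋆ K_ε`, `(u_L·u_L)^ε + (u_T·u_T)^ε = |u|² ⋆ K_ε`,
`((u_L·u_L)u)^ε + ((u_T·u_T)u)^ε = (|u|²u) ⋆ K_ε`, `p_L^ε + p_T^ε = p ⋆ K_ε` at a.e. `(t,x)`; the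
bridges `Torus.vecConv_mollifierKernel_apply`, `Torus.convolution_mollifierKernel_apply`), whence
`𝓔_L + 𝓔_T = A₁ − A₂ + 2A₃ + 2A₅ + 2E + 2F` (`Torus.eyinkBalanceL_add_eyinkBalanceT_eq_sum`, Fubini),
and the assembly `𝓔_L = 4∫∫D_εψ − (4(d−1)/d)∫∫D_Tψ = (4/d)∫∫D_Lψ`, first for radial unit-ball
mollifiers and then for every radial mollifier by rescaling to the unit ball (all objects depend on
`φ` only through `φ^ε = (φ_R)^{εR}`).

## References

* G. L. Eyink, *Local 4/5-law and energy dissipation anomaly in turbulence*, Nonlinearity 16 (2003)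
  137–145 = arXiv:nlin/0208004, §2, proof of Thm. 1: (u-LT)–(moll-u-LT) (`u = u_L + u_T`),
  (phi-LT) (`φ_L = φ − φ_T`), (uuL-eq), (uuT-eq), and Thm. 1 (the integrands of `D_L^ε`, `D_T^ε`).
  [Eyink2003]
* J. Duchon, R. Robert, *Inertial energy dissipation for weak solutions of incompressible Euler and
  Navier–Stokes equations*, Nonlinearity 13 (2000) 249–255, proof of Prop. 1 (pp. 250–251), Prop. 2.
  [DuchonRobert2000]
-/

noncomputable section

open MeasureTheory TopologicalSpace Set Function Filter Metric
open _root_.Topology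
open scoped ENNReal NNReal Convolution ContDiff InnerProductSpace RealInnerProductSpace

namespace Literature.Analysis.FluidPDE.Torus

variable {d : Type*} [Fintype d]

/-! ## Dependence on the kernel `φ^ε` only; rescaling to the unit ball -/

section Kernel

variable {T : ℝ} {u : ℝ → UnitAddTorus d → EuclideanSpace ℝ d} {p : ℝ → UnitAddTorus d → ℝ}
  {ψ : ℝ → UnitAddTorus d → ℝ} {φ φ₁ φ₂ : EuclideanSpace ℝ d → ℝ} {ε ε₁ ε₂ R : ℝ}

/-- Eyink's longitudinal balance pairing depends on `(φ, ε)` only through the kernel `φ^ε`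
(`p_L^ε` is built from `(φ^ε)_L = φ^ε − (φ^ε)_T`). [folklore] -/
theorem eyinkBalanceL_congr_kernel (h : FluidPDE.mollifierScale ε₁ φ₁ = FluidPDE.mollifierScale ε₂ φ₂) :
    eyinkBalanceL T u p φ₁ ε₁ ψ = eyinkBalanceL T u p φ₂ ε₂ ψ := by
  unfold eyinkBalanceL eyinkVelocityL eyinkEnergyL eyinkEnergyFluxL eyinkPressureL
  rw [h]

/-- Eyink's longitudinal approximant depends on `(φ, ε)` only through the kernel `φ^ε`. [folklore] -/
theorem eyinkLongitudinalApprox_congr_kernel (h : FluidPDE.mollifierScale ε₁ φ₁ = FluidPDE.mollifierScale ε₂ φ₂) :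
    eyinkLongitudinalApprox φ₁ ε₁ = eyinkLongitudinalApprox φ₂ ε₂ := by
  funext v x
  unfold eyinkLongitudinalApprox eyinkLongitudinalIntegrand
  rw [h]

/-- **The rescaled profile `φ_R = R^d φ(R·)` of a radial mollifier supported in the ball of radius
`R > 0`** is a radial unit-ball mollifier. [folklore] -/
theorem isRadialUnitBallMollifier_rescale (hφ : FluidPDE.IsMollifier φ)
    (hrad : ∀ ξ η : EuclideanSpace ℝ d, ‖ξ‖ = ‖η‖ → φ ξ = φ η) (hR : 0 < R)
    (hsupp : ∀ ξ : EuclideanSpace ℝ d, R < ‖ξ‖ → φ ξ = 0) :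
    IsRadialUnitBallMollifier (FluidPDE.mollifierScale R⁻¹ φ) := by
  have h1 : FluidPDE.IsMollifier (FluidPDE.mollifierScale R⁻¹ φ) := hφ.mollifierScale (inv_pos.2 hR)
  have h2 : ∀ ξ : EuclideanSpace ℝ d, 1 < ‖ξ‖ → FluidPDE.mollifierScale R⁻¹ φ ξ = 0 := by
    intro ξ hξ
    rw [FluidPDE.mollifierScale_apply, hsupp _ ?_, mul_zero]
    rw [inv_inv, norm_smul, Real.norm_eq_abs, abs_of_pos hR]
    calc R = R * 1 := (mul_one R).symm
      _ < R * ‖ξ‖ := by gcongr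
  have h3 : ∀ x y : EuclideanSpace ℝ d, ‖x‖ = ‖y‖ →
      FluidPDE.mollifierScale R⁻¹ φ x = FluidPDE.mollifierScale R⁻¹ φ y := mollifierScale_radial hrad R⁻¹
  exact ⟨⟨h1, h2⟩, h3⟩

end Kernel

/-! ## The flux split `D_ε = d⁻¹ D_L^ε + ((d−1)/d) D_T^ε` on `ψ`-pairings -/

section Flux

variable {T : ℝ} {u : ℝ → UnitAddTorus d → EuclideanSpace ℝ d} {ψ : ℝ → UnitAddTorus d → ℝ}
  {φ : EuclideanSpace ℝ d → ℝ} {ε : ℝ}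

/-- **Duchon–Robert's pairing splits into Eyink's two** (`d ≥ 2`, radial unit-ball mollifier `φ`,
`ε > 0`, `u ∈ L³((0,T) × T^d)` jointly measurable, `ψ` a test function supported in `(0,T)`):
`∫₀ᵀ∫ D_ε^φ(u) ψ = d⁻¹ ∫₀ᵀ∫ D_L^{ε,φ}(u) ψ + ((d−1)/d) ∫₀ᵀ∫ D_T^{ε,φ}(u) ψ` — the integrated form of
`∇φ^ε·δu|δu|² = {∇φ^ε·δu(δu_L)² + (2/|ξ|)φ^εδu_L|δu_T|²} + {∇φ^ε·δu|δu_T|² − (2/|ξ|)φ^εδu_L|δu_T|²}`,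
i.e. of `4D_ε = (4/d)D_L^ε + (4(d−1)/d)D_T^ε` (Eyink 2003, proof of Thm. 1, with `4/3`, `8/3` in
`d = 3`), through the polar formulas `integral_duchonRobertApprox_eq_radial`,
`integral_eyinkApprox_eq` and the splitting of the shell pairing `energyFluxShellPairing_eq_add`
(the computation inside `HasUniformEyinkDefect.tendsto_duchonRobertApprox`). [cite: Eyink2003, §2 Thm. 1] -/
theorem integral_duchonRobertApprox_eq_longitudinal_add_transverse (hn2 : 2 ≤ Fintype.card d)
    (hum : AEStronglyMeasurable (FunctionSpaces.Torus.stLift u) (volume.restrict (Ioo 0 T ×ˢ univ)))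
    (hu3 : ∫⁻ t in Ioo 0 T, ∫⁻ x, ‖u t x‖ₑ ^ 3 < ⊤)
    (hφ : IsRadialUnitBallMollifier φ) (hψ : FunctionSpaces.Torus.IsSpaceTimeTestIoo T ψ) (hε : 0 < ε) :
    ∫ t in Ioo 0 T, ∫ x, duchonRobertApprox φ ε (u t) x * ψ t x =
      (Fintype.card d : ℝ)⁻¹ * (∫ t in Ioo 0 T, ∫ x, eyinkLongitudinalApprox φ ε (u t) x * ψ t x) +
        ((Fintype.card d : ℝ) - 1) / Fintype.card d *
          (∫ t in Ioo 0 T, ∫ x, eyinkTransverseApprox φ ε (u t) x * ψ t x) := by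
  haveI : Nonempty d := Fintype.card_pos_iff.1 (by omega)
  set μp : Measure (ℝ × UnitAddTorus d) := (volume.restrict (Ioo 0 T)).prod volume with hμp
  have hu : AEStronglyMeasurable (uncurry u) μp := aestronglyMeasurable_uncurry_prod_of_stLift_Ioo hum
  have hu3' : ∫⁻ p, ‖uncurry u p‖ₑ ^ 3 ∂μp < ⊤ := lintegral_prod_enorm_pow_three_lt_top hu hu3
  have hψm : AEStronglyMeasurable (uncurry ψ) μp := hψ.continuous_uncurry.aestronglyMeasurable
  obtain ⟨Cψ, hψb⟩ := hψ.exists_abs_le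
  obtain ⟨m, hnm⟩ : ∃ m : ℕ, Fintype.card d = m + 2 := ⟨Fintype.card d - 2, by omega⟩
  set n : ℕ := Fintype.card d with hndef
  have hnR : (n : ℝ) = (m : ℝ) + 2 := by rw [hnm]; push_cast; ring
  set c : ℝ := (volume : Measure (EuclideanSpace ℝ d)).toSphere.real univ with hcdef
  obtain ⟨e₀, he₀⟩ : ∃ e : EuclideanSpace ℝ d, ‖e‖ = 1 := by
    classical
    obtain ⟨i⟩ := ‹Nonempty d›
    exact ⟨EuclideanSpace.single i 1, by simp⟩
  -- the two shell pairings and shell functions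
  set IL : ℝ → ℝ := cubicShellPairing (fun (o v : EuclideanSpace ℝ d) => ⟪v, o⟫ ^ 3) T u ψ with hILdef
  set IT : ℝ → ℝ := cubicShellPairing
    (fun (o v : EuclideanSpace ℝ d) => ⟪v, o⟫ * ‖v - ⟪v, o⟫ • o‖ ^ 2) T u ψ with hITdef
  have hILc : Continuous IL := continuous_cubicShellPairing_L hu hu3' hψm hψb
  have hITc : Continuous IT := continuous_cubicShellPairing_T hu hu3' hψm hψb
  set gL : ℝ → ℝ := fun r => r⁻¹ * IL r with hgLdef
  set gT : ℝ → ℝ := fun r => r⁻¹ * IT r with hgTdef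
  -- the profile of `φ`
  set Φ : ℝ → ℝ := fun r => φ (r • e₀) with hΦ
  have hΦ1 : ContDiff ℝ 1 Φ := (hφ.1.1.1.of_le (by simp)).comp (contDiff_id.smul contDiff_const)
  have hΦsupp : ∀ r, 1 < r → Φ r = 0 := fun r hr =>
    hφ.1.2 _ (by rw [norm_smul, he₀, mul_one, Real.norm_eq_abs]; exact hr.trans_le (le_abs_self r))
  have hΦ'supp : ∀ r, 1 < r → deriv Φ r = 0 := fun r hr => deriv_eq_zero_of_forall_gt hΦsupp hr
  have hΦ'c : Continuous (deriv Φ) := hΦ1.continuous_deriv le_rfl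
  have e1 : ∫ t in Ioo 0 T, ∫ x, duchonRobertApprox φ ε (u t) x * ψ t x =
      4⁻¹ * c * ∫ x in Ioi (0 : ℝ), x ^ n * deriv Φ x *
        ((ε * x)⁻¹ * energyFluxShellPairing T u ψ (ε * x)) :=
    integral_duchonRobertApprox_eq_radial (T := T) (u := u) (ψ := ψ) hφ.1 hφ.2 he₀ hu hu3' hψm hψb hε
  have e2 := integral_eyinkApprox_eq (T := T) (u := u) (ψ := ψ) hn2 hφ.1.1 hφ.2 hφ.1.2 he₀ hu hu3'
    hψm hψb hε
  have e2L : ∫ t in Ioo 0 T, ∫ x, eyinkLongitudinalApprox φ ε (u t) x * ψ t x =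
      eyinkLongitudinalConst d * c *
        ((∫ x in Ioi (0 : ℝ), x ^ n * deriv Φ x * gL (ε * x)) +
          ∫ x in Ioi (0 : ℝ), 2 * x ^ (n - 1) * Φ x * gT (ε * x)) := e2.1
  have e2T : ∫ t in Ioo 0 T, ∫ x, eyinkTransverseApprox φ ε (u t) x * ψ t x =
      eyinkTransverseConst d * c *
        ((∫ x in Ioi (0 : ℝ), x ^ n * deriv Φ x * gT (ε * x)) -
          ∫ x in Ioi (0 : ℝ), 2 * x ^ (n - 1) * Φ x * gT (ε * x)) := e2.2
  -- the Duchon–Robert integrand splits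
  have hsum : ∀ x : ℝ, (ε * x)⁻¹ * energyFluxShellPairing T u ψ (ε * x) = gL (ε * x) + gT (ε * x) := by
    intro x
    simp only [hgLdef, hgTdef, hILdef, hITdef]
    rw [energyFluxShellPairing_eq_add hu hu3' hψm hψb, mul_add]
  have hintL : IntegrableOn (fun x : ℝ => x ^ n * deriv Φ x * gL (ε * x)) (Ioi 0) := by
    have := integrableOn_pow_mul_mul_shellFunction hΦ'c hΦ'supp hILc (m + 1) hε
    rw [← hnm] at this
    exact this
  have hintT : IntegrableOn (fun x : ℝ => x ^ n * deriv Φ x * gT (ε * x)) (Ioi 0) := by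
    have := integrableOn_pow_mul_mul_shellFunction hΦ'c hΦ'supp hITc (m + 1) hε
    rw [← hnm] at this
    exact this
  have hsplit : ∫ x in Ioi (0 : ℝ), x ^ n * deriv Φ x * ((ε * x)⁻¹ * energyFluxShellPairing T u ψ (ε * x)) =
      (∫ x in Ioi (0 : ℝ), x ^ n * deriv Φ x * gL (ε * x)) +
        ∫ x in Ioi (0 : ℝ), x ^ n * deriv Φ x * gT (ε * x) := by
    rw [← integral_add hintL hintT]
    refine setIntegral_congr_fun measurableSet_Ioi fun x _ => ?_
    rw [hsum x, mul_add]
  rw [e1, e2L, e2T, hsplit]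
  simp only [eyinkLongitudinalConst, eyinkTransverseConst, ← hndef]
  have hm1 : (n : ℝ) - 1 ≠ 0 := by rw [hnR]; have : (0:ℝ) ≤ m := Nat.cast_nonneg m; linarith
  have hn0 : (n : ℝ) ≠ 0 := by rw [hnR]; have : (0:ℝ) ≤ m := Nat.cast_nonneg m; linarith
  field_simp
  ring

end Flux

/-! ## Integrability of the six pieces of `𝓔_L^{ε,φ}(ψ)` -/

section PiecesL

variable [Nonempty d] {T ε : ℝ} {φ : EuclideanSpace ℝ d → ℝ} {u : ℝ → UnitAddTorus d → EuclideanSpace ℝ d}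
  {p : ℝ → UnitAddTorus d → ℝ} {ψ : ℝ → UnitAddTorus d → ℝ}

/-- **Integrability of the six pieces of `𝓔_L^{ε,φ}(ψ)`** on `(0,T) × T^d` for `u ∈ L³`, `p ∈ L^{3/2}`,
a spherically symmetric unit-ball mollifier `φ`, `ε > 0` and a test function `ψ`:
`⟪u,u_L^ε⟫∂ₜψ`, `⟪u,u_L^ε⟫⟪u,∇ψ⟫`, `⟪((u_L·u_L)u)^ε,∇ψ⟫`, `(u_L·u_L)^ε⟪u,∇ψ⟫`, `p⟪u_L^ε,∇ψ⟫`,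
`p_L^ε⟪u,∇ψ⟫` (the Type I–IV integrability of `EyinkBalanceLimits` for the projection family
`P_L(ξ̂)` and the kernels `φ^ε`, `φ_L^ε`, with the crude translation moduli `2‖u‖₃`, `2‖p‖_{3/2}`; the
longitudinal twin of `eyink_piecesT_integrable`). [folklore] -/
theorem eyink_piecesL_integrable
    (hum : AEStronglyMeasurable (FunctionSpaces.Torus.stLift u) (volume.restrict (Ioo 0 T ×ˢ univ)))
    (hu3 : ∫⁻ t in Ioo 0 T, ∫⁻ x, ‖u t x‖ₑ ^ 3 < ⊤)
    (hpm : AEStronglyMeasurable (FunctionSpaces.Torus.stLift p) (volume.restrict (Ioo 0 T ×ˢ univ)))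
    (hp32 : ∫⁻ t in Ioo 0 T, ∫⁻ x, ‖p t x‖ₑ ^ (3 / 2 : ℝ) < ⊤)
    (hφ : IsUnitBallMollifier φ) (hrad : ∀ ξ η : EuclideanSpace ℝ d, ‖ξ‖ = ‖η‖ → φ ξ = φ η) (hε : 0 < ε)
    (hψ : FunctionSpaces.Torus.IsSpaceTimeTestIoo T ψ) :
    Integrable (fun q : ℝ × UnitAddTorus d =>
        ⟪u q.1 q.2, eyinkVelocityL φ ε (u q.1) q.2⟫ * FunctionSpaces.Torus.timeDeriv ψ q.1 q.2) (stMeasure d T) ∧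
      Integrable (fun q : ℝ × UnitAddTorus d =>
        ⟪u q.1 q.2, eyinkVelocityL φ ε (u q.1) q.2⟫ * ⟪u q.1 q.2, FunctionSpaces.Torus.gradient (ψ q.1) q.2⟫) (stMeasure d T) ∧
      Integrable (fun q : ℝ × UnitAddTorus d =>
        ⟪eyinkEnergyFluxL φ ε (u q.1) q.2, FunctionSpaces.Torus.gradient (ψ q.1) q.2⟫) (stMeasure d T) ∧
      Integrable (fun q : ℝ × UnitAddTorus d =>
        eyinkEnergyL φ ε (u q.1) q.2 * ⟪u q.1 q.2, FunctionSpaces.Torus.gradient (ψ q.1) q.2⟫) (stMeasure d T) ∧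
      Integrable (fun q : ℝ × UnitAddTorus d =>
        p q.1 q.2 * ⟪eyinkVelocityL φ ε (u q.1) q.2, FunctionSpaces.Torus.gradient (ψ q.1) q.2⟫) (stMeasure d T) ∧
      Integrable (fun q : ℝ × UnitAddTorus d =>
        eyinkPressureL φ ε (p q.1) q.2 * ⟪u q.1 q.2, FunctionSpaces.Torus.gradient (ψ q.1) q.2⟫) (stMeasure d T) := by
  set ν := stMeasure d T with hν
  -- product forms of the data
  have hu : AEStronglyMeasurable (uncurry u) ν := aestronglyMeasurable_uncurry_prod_of_stLift_Ioo hum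
  have hu3' : ∫⁻ q, ‖uncurry u q‖ₑ ^ (3 : ℝ) ∂ν < ⊤ := by
    have h := lintegral_prod_enorm_pow_three_lt_top hu hu3
    have e : ∫⁻ q, ‖uncurry u q‖ₑ ^ 3 ∂ν = ∫⁻ q, ‖uncurry u q‖ₑ ^ (3 : ℝ) ∂ν :=
      lintegral_congr fun q => ENNReal.pow_three_eq_rpow _
    rw [← e]; exact h
  have hu1 : ∫⁻ q, ‖uncurry u q‖ₑ ∂ν < ⊤ := by
    have h := lintegral_enorm_rpow_lt_top_of_le hu (by norm_num) hu3' one_pos (by norm_num : (1 : ℝ) ≤ 3)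
    simpa only [ENNReal.rpow_one] using h
  have hp : AEStronglyMeasurable (uncurry p) ν := aestronglyMeasurable_uncurry_prod_of_stLift_Ioo' hpm
  have hp32' : ∫⁻ q, ‖uncurry p q‖ₑ ^ (3 / 2 : ℝ) ∂ν < ⊤ := by
    have e := lintegral_Ioo_lintegral_eq_lintegral_prod (T := T) (g := fun t x => ‖p t x‖ₑ ^ (3 / 2 : ℝ))
      (hp.enorm.pow_const _)
    rw [e] at hp32
    exact hp32
  -- test data
  obtain ⟨Cψ, hCψ, hθb, hHb, hθm, hHm⟩ := hψ.testData_bound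
  set θ : ℝ × UnitAddTorus d → ℝ := fun q => FunctionSpaces.Torus.timeDeriv ψ q.1 q.2 with hθdef
  set Hψ : ℝ × UnitAddTorus d → EuclideanSpace ℝ d := fun q => FunctionSpaces.Torus.gradient (ψ q.1) q.2 with hHdef
  have hθm' : AEStronglyMeasurable θ ν := hθm
  have hHm' : AEStronglyMeasurable Hψ ν := hHm
  -- the weight `g = ⟪u, ∇ψ⟫ ∈ L³`
  set g : ℝ × UnitAddTorus d → ℝ := fun q => ⟪uncurry u q, Hψ q⟫ with hgdef
  have hgm : AEStronglyMeasurable g ν := hu.inner hHm'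
  have hgb : ∀ q, |g q| ≤ Cψ * ‖uncurry u q‖ := fun q => by
    calc |⟪uncurry u q, Hψ q⟫| ≤ ‖uncurry u q‖ * ‖Hψ q‖ := abs_real_inner_le_norm _ _
      _ ≤ ‖uncurry u q‖ * Cψ := by gcongr; exact hHb q.1 q.2
      _ = Cψ * ‖uncurry u q‖ := mul_comm _ _
  have hg3 : ∫⁻ q, ‖g q‖ₑ ^ (3 : ℝ) ∂ν < ⊤ := lintegral_enorm_rpow_three_lt_top_of_le hCψ hgb hu3'
  -- the three Type-I weights in `L^{3/2}`
  have hu32 : ∫⁻ q, ‖uncurry u q‖ₑ ^ (3 / 2 : ℝ) ∂ν < ⊤ :=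
    lintegral_enorm_rpow_lt_top_of_le hu (by norm_num) hu3' (by norm_num) (by norm_num)
  set c₁ : ℝ × UnitAddTorus d → EuclideanSpace ℝ d := fun q => θ q • uncurry u q with hc₁
  set c₂ : ℝ × UnitAddTorus d → EuclideanSpace ℝ d := fun q => g q • uncurry u q with hc₂
  set c₃ : ℝ × UnitAddTorus d → EuclideanSpace ℝ d := fun q => uncurry p q • Hψ q with hc₃
  have hc₁m : AEStronglyMeasurable c₁ ν := hθm'.smul hu
  have hc₂m : AEStronglyMeasurable c₂ ν := hgm.smul hu
  have hc₃m : AEStronglyMeasurable c₃ ν := hp.smul hHm'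
  have hc₁32 : ∫⁻ q, ‖c₁ q‖ₑ ^ (3 / 2 : ℝ) ∂ν < ⊤ := by
    refine lintegral_enorm_rpow_lt_top_of_norm_le hCψ (by norm_num) (fun q => ?_) hu32
    rw [hc₁, norm_smul, Real.norm_eq_abs]
    gcongr
    exact hθb q.1 q.2
  have hc₂32 : ∫⁻ q, ‖c₂ q‖ₑ ^ (3 / 2 : ℝ) ∂ν < ⊤ := by
    have hsq : ∫⁻ q, ‖‖uncurry u q‖ ^ 2‖ₑ ^ (3 / 2 : ℝ) ∂ν < ⊤ := by
      have e : ∀ q, ‖‖uncurry u q‖ ^ 2‖ₑ ^ (3 / 2 : ℝ) = ‖uncurry u q‖ₑ ^ (3 : ℝ) := fun q => by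
        rw [enorm_norm_pow, ENNReal.sq_rpow_three_halves]
      simp only [e]; exact hu3'
    refine lintegral_enorm_rpow_lt_top_of_norm_le hCψ (by norm_num) (fun q => ?_) hsq
    show ‖g q • uncurry u q‖ ≤ Cψ * ‖‖uncurry u q‖ ^ 2‖
    rw [norm_smul, Real.norm_eq_abs, Real.norm_of_nonneg (sq_nonneg _), sq, ← mul_assoc]
    gcongr
    exact hgb q
  have hc₃32 : ∫⁻ q, ‖c₃ q‖ₑ ^ (3 / 2 : ℝ) ∂ν < ⊤ := by
    refine lintegral_enorm_rpow_lt_top_of_norm_le hCψ (by norm_num) (fun q => ?_) hp32'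
    rw [hc₃, norm_smul, mul_comm]
    gcongr
    exact hHb q.1 q.2
  -- kernels, projections, angular identities
  have hd1 : 1 ≤ Fintype.card d := Fintype.card_pos
  obtain ⟨hk, hksupp, -, -⟩ := mollifierScale_kernel_facts hφ hε
  have hkrad := mollifierScale_radial hrad ε
  obtain ⟨hkL, hkLsupp, -, -⟩ := longitudinalKernel_scaled_facts hφ hd1 hε
  have hAL : ∀ ξ v : EuclideanSpace ℝ d, ‖projL (‖ξ‖⁻¹ • ξ) v‖ ≤ 1 * ‖v‖ := fun ξ v => norm_projL_unit_le ξ v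
  have hAngI : ∀ a c : EuclideanSpace ℝ d, ∫ ξ, FluidPDE.mollifierScale ε φ ξ * ⟪projL (‖ξ‖⁻¹ • ξ) a, c⟫ =
      ((Fintype.card d : ℝ)⁻¹ * ∫ ξ, FluidPDE.mollifierScale ε φ ξ) * ⟪a, c⟫ := fun a c =>
    integral_mul_inner_projL hk hkrad a c
  have hAngII : ∀ a : EuclideanSpace ℝ d, ∫ ξ, FluidPDE.mollifierScale ε φ ξ * ‖projL (‖ξ‖⁻¹ • ξ) a‖ ^ 2 =
      ((Fintype.card d : ℝ)⁻¹ * ∫ ξ, FluidPDE.mollifierScale ε φ ξ) * ‖a‖ ^ 2 := fun a =>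
    integral_mul_norm_projL_sq hk hkrad a
  -- crude moduli
  set m : ℝ≥0∞ := 2 * (∫⁻ q, ‖uncurry u q‖ₑ ^ (3 : ℝ) ∂ν) ^ (1 / 3 : ℝ) with hmdef
  have hm : m ≠ ⊤ := ENNReal.mul_ne_top (by simp) (ENNReal.rpow_ne_top_of_nonneg (by norm_num) hu3'.ne)
  have hmod : ∀ ξ : EuclideanSpace ℝ d, ‖ξ‖ ≤ ε →
      (∫⁻ q, ‖uncurry u (stTranslate d ξ q) - uncurry u q‖ₑ ^ (3 : ℝ) ∂ν) ^ (1 / 3 : ℝ) ≤ m := fun ξ _ =>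
    lintegral_translate_sub_rpow_le hu (by norm_num) ξ
  set mP : ℝ≥0∞ := 2 * (∫⁻ q, ‖uncurry p q‖ₑ ^ (3 / 2 : ℝ) ∂ν) ^ (2 / 3 : ℝ) with hmPdef
  have hmP : mP ≠ ⊤ := ENNReal.mul_ne_top (by simp) (ENNReal.rpow_ne_top_of_nonneg (by norm_num) hp32'.ne)
  have hmodP : ∀ ξ : EuclideanSpace ℝ d, ‖ξ‖ ≤ ε →
      (∫⁻ q, ‖uncurry p (stTranslate d ξ q) - uncurry p q‖ₑ ^ (3 / 2 : ℝ) ∂ν) ^ (2 / 3 : ℝ) ≤ mP := fun ξ _ => by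
    have h := lintegral_translate_sub_rpow_le hp (by norm_num : (1 : ℝ) ≤ 3 / 2) ξ
    have e : (1 : ℝ) / (3 / 2) = 2 / 3 := by norm_num
    simpa only [e] using h
  -- the unfolding lemmas
  have hV : ∀ q : ℝ × UnitAddTorus d, eyinkVelocityL φ ε (u q.1) q.2 =
      ∫ ξ, FluidPDE.mollifierScale ε φ ξ • projL (‖ξ‖⁻¹ • ξ) (uncurry u (stTranslate d ξ q)) := fun q =>
    (eyink_objectsL_eq φ ε (u q.1) q.2).1
  have hE : ∀ q : ℝ × UnitAddTorus d, eyinkEnergyL φ ε (u q.1) q.2 =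
      ∫ ξ, FluidPDE.mollifierScale ε φ ξ * ‖projL (‖ξ‖⁻¹ • ξ) (uncurry u (stTranslate d ξ q))‖ ^ 2 := fun q =>
    (eyink_objectsL_eq φ ε (u q.1) q.2).2.1
  have hF : ∀ q : ℝ × UnitAddTorus d, eyinkEnergyFluxL φ ε (u q.1) q.2 =
      ∫ ξ, (FluidPDE.mollifierScale ε φ ξ * ‖projL (‖ξ‖⁻¹ • ξ) (uncurry u (stTranslate d ξ q))‖ ^ 2) •
        uncurry u (stTranslate d ξ q) := fun q =>
    (eyink_objectsL_eq φ ε (u q.1) q.2).2.2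
  have hP : ∀ q : ℝ × UnitAddTorus d, eyinkPressureL φ ε (p q.1) q.2 =
      ∫ ξ, eyinkLongitudinalKernel d (FluidPDE.mollifierScale ε φ) ξ * uncurry p (stTranslate d ξ q) := fun q =>
    eyinkPressureL_apply φ ε (p q.1) q.2
  -- Type I pieces
  have pieceI : ∀ {c : ℝ × UnitAddTorus d → EuclideanSpace ℝ d}, AEStronglyMeasurable c ν →
      (∫⁻ q, ‖c q‖ₑ ^ (3 / 2 : ℝ) ∂ν < ⊤) →
      Integrable (fun q : ℝ × UnitAddTorus d => ⟪eyinkVelocityL φ ε (u q.1) q.2, c q⟫) ν := by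
    intro c hcm hc32
    obtain ⟨hI, -⟩ := typeI_estimate (T := T) hk hksupp projL zero_le_one hAL continuous_projL hAngI
      hu hu3' hcm hc32 hm hmod
    have hae := ae_inner_integral_kernel_smul_eq (T := T) hk projL hAL continuous_projL hu hu1 c
    refine (hI.integral_prod_left).congr ?_
    filter_upwards [hae] with q hq
    rw [hV q, hq.2]
  have hunc : ∀ q : ℝ × UnitAddTorus d, uncurry u q = u q.1 q.2 := fun q => rfl
  have huncp : ∀ q : ℝ × UnitAddTorus d, uncurry p q = p q.1 q.2 := fun q => rfl
  refine ⟨?_, ?_, ?_, ?_, ?_, ?_⟩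
  · refine (pieceI hc₁m hc₁32).congr (ae_of_all _ fun q => ?_)
    simp only [hc₁, real_inner_smul_right, hunc, hθdef]
    rw [real_inner_comm]
    ring
  · refine (pieceI hc₂m hc₂32).congr (ae_of_all _ fun q => ?_)
    simp only [hc₂, real_inner_smul_right, hunc, hgdef, hHdef]
    rw [real_inner_comm (eyinkVelocityL φ ε (u q.1) q.2)]
    ring
  · -- Type III
    obtain ⟨hI, -⟩ := typeIII_estimate (T := T) hk hksupp projL zero_le_one hAL continuous_projL hAngII
      hu hu3' hHm' hCψ (fun q => hHb q.1 q.2) hm hmod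
    have hae := ae_inner_integral_kernel_normSq_smul_eq (T := T) hk projL hAL continuous_projL hu hu3' Hψ
    refine (hI.integral_prod_left).congr ?_
    filter_upwards [hae] with q hq
    rw [hF q, hq.2]
  · -- Type II
    obtain ⟨hI, -⟩ := typeII_estimate (T := T) hk hksupp projL zero_le_one hAL continuous_projL hAngII
      hu hu3' hgm hg3 hm hmod
    refine (hI.integral_prod_left).congr (ae_of_all _ fun q => ?_)
    simp only
    rw [hE q, ← integral_mul_const]
    refine integral_congr_ae (ae_of_all _ fun ξ => ?_)
    simp only [hgdef, hunc, hHdef]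
    ring
  · refine (pieceI hc₃m hc₃32).congr (ae_of_all _ fun q => ?_)
    simp only [hc₃, real_inner_smul_right, huncp, hHdef]
  · -- Type IV
    obtain ⟨hI, -⟩ := typeIV_estimate (T := T) hkL hkLsupp hp hp32' hgm hg3 hmP hmodP
    refine (hI.integral_prod_left).congr (ae_of_all _ fun q => ?_)
    simp only
    rw [hP q, ← integral_mul_const]
    refine integral_congr_ae (ae_of_all _ fun ξ => ?_)
    simp only [hgdef, hunc, hHdef]
    ring

end PiecesL

/-! ## A.e. additivity of Eyink's objects: `X_L + X_T = X` through the torus kernel `K_ε` -/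

section Additivity

variable {T ε : ℝ} {φ : EuclideanSpace ℝ d → ℝ} {u : ℝ → UnitAddTorus d → EuclideanSpace ℝ d}
  {p : ℝ → UnitAddTorus d → ℝ}

/-- A.e. integrability in the separation of `ξ ↦ k(ξ) a(t, x+ξ)` for `k ∈ L¹(ℝ^d)` and a real
`a ∈ L¹((0,T) × T^d)` (Tonelli, `ae_integrable_kernel_mul_translate`). [folklore] -/
theorem ae_integrable_kernel_mul_translate_real {k : EuclideanSpace ℝ d → ℝ} (hk : Integrable k volume)
    {a : ℝ × UnitAddTorus d → ℝ} (ha : AEStronglyMeasurable a (stMeasure d T))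
    (ha1 : ∫⁻ q, ‖a q‖ₑ ∂(stMeasure d T) < ⊤) :
    ∀ᵐ q ∂(stMeasure d T), Integrable (fun ξ : EuclideanSpace ℝ d => k ξ * a (stTranslate d ξ q)) volume := by
  obtain ⟨hdom, -⟩ := ae_integrable_kernel_mul_translate (T := T) hk ha ha1
  have hkm : AEStronglyMeasurable (fun q : (ℝ × UnitAddTorus d) × EuclideanSpace ℝ d => k q.2)
      ((stMeasure d T).prod volume) := hk.aestronglyMeasurable.comp_snd
  have ham : AEStronglyMeasurable (fun q : (ℝ × UnitAddTorus d) × EuclideanSpace ℝ d => a (stTranslate d q.2 q.1))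
      ((stMeasure d T).prod volume) := aestronglyMeasurable_comp_stTranslate ha
  have h : Integrable (fun q : (ℝ × UnitAddTorus d) × EuclideanSpace ℝ d => k q.2 * a (stTranslate d q.2 q.1))
      ((stMeasure d T).prod volume) :=
    hdom.mono' (hkm.mul ham) (ae_of_all _ fun q => by rw [norm_mul])
  exact h.prod_right_ae

/-- A.e. integrability in the separation of `ξ ↦ k(ξ) ‖A(ξ̂) u(t,x+ξ)‖²` for `k ∈ L¹(ℝ^d)`, a bounded
continuous projection family `A` and `u ∈ L²((0,T) × T^d)`. [folklore] -/
theorem ae_integrable_kernel_mul_norm_proj_sq {k : EuclideanSpace ℝ d → ℝ} (hk : Integrable k volume)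
    (A : EuclideanSpace ℝ d → EuclideanSpace ℝ d →L[ℝ] EuclideanSpace ℝ d) {CA : ℝ}
    (hA : ∀ ξ v : EuclideanSpace ℝ d, ‖A (‖ξ‖⁻¹ • ξ) v‖ ≤ CA * ‖v‖)
    (hAc : Continuous fun z : EuclideanSpace ℝ d × EuclideanSpace ℝ d => A z.1 z.2)
    {u' : ℝ × UnitAddTorus d → EuclideanSpace ℝ d} (hu : AEStronglyMeasurable u' (stMeasure d T))
    (hu2 : ∫⁻ q, ‖u' q‖ₑ ^ (2 : ℝ) ∂(stMeasure d T) < ⊤) :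
    ∀ᵐ q ∂(stMeasure d T),
      Integrable (fun ξ : EuclideanSpace ℝ d => k ξ * ‖A (‖ξ‖⁻¹ • ξ) (u' (stTranslate d ξ q))‖ ^ 2) volume := by
  set ν := stMeasure d T with hν
  have hsqm : AEStronglyMeasurable (fun q : ℝ × UnitAddTorus d => ‖u' q‖ ^ 2) ν := hu.norm.pow 2
  have hsq1 : ∫⁻ q, ‖‖u' q‖ ^ 2‖ₑ ∂ν < ⊤ := by
    have e : ∫⁻ q, ‖‖u' q‖ ^ 2‖ₑ ∂ν = ∫⁻ q, ‖u' q‖ₑ ^ (2 : ℝ) ∂ν :=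
      lintegral_congr fun q => by rw [enorm_norm_pow, ENNReal.rpow_two]
    rw [e]; exact hu2
  obtain ⟨hdom, -⟩ := ae_integrable_kernel_mul_translate (T := T) hk hsqm hsq1
  have hunit : Measurable fun ξ : EuclideanSpace ℝ d => ‖ξ‖⁻¹ • ξ := measurable_unitDir
  have hAτm : AEStronglyMeasurable (fun q : (ℝ × UnitAddTorus d) × EuclideanSpace ℝ d =>
      A (‖q.2‖⁻¹ • q.2) (u' (stTranslate d q.2 q.1))) (ν.prod volume) :=
    hAc.comp_aestronglyMeasurable ((hunit.comp measurable_snd).aestronglyMeasurable.prodMk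
      (aestronglyMeasurable_comp_stTranslate hu))
  have hkm : AEStronglyMeasurable (fun q : (ℝ × UnitAddTorus d) × EuclideanSpace ℝ d => k q.2) (ν.prod volume) :=
    hk.aestronglyMeasurable.comp_snd
  have h : Integrable (fun q : (ℝ × UnitAddTorus d) × EuclideanSpace ℝ d =>
      k q.2 * ‖A (‖q.2‖⁻¹ • q.2) (u' (stTranslate d q.2 q.1))‖ ^ 2) (ν.prod volume) := by
    refine (hdom.const_mul (CA ^ 2)).mono' (hkm.mul (hAτm.norm.pow 2)) (ae_of_all _ fun q => ?_)
    rw [norm_mul, Real.norm_eq_abs, Real.norm_eq_abs,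
      abs_of_nonneg (sq_nonneg ‖A (‖q.2‖⁻¹ • q.2) (u' (stTranslate d q.2 q.1))‖)]
    have hq : ‖A (‖q.2‖⁻¹ • q.2) (u' (stTranslate d q.2 q.1))‖ ^ 2 ≤ CA ^ 2 * ‖u' (stTranslate d q.2 q.1)‖ ^ 2 := by
      rw [← mul_pow]; exact pow_le_pow_left₀ (norm_nonneg _) (hA _ _) 2
    calc |k q.2| * ‖A (‖q.2‖⁻¹ • q.2) (u' (stTranslate d q.2 q.1))‖ ^ 2
        ≤ |k q.2| * (CA ^ 2 * ‖u' (stTranslate d q.2 q.1)‖ ^ 2) := by gcongr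
      _ = CA ^ 2 * (‖k q.2‖ * ‖‖u' (stTranslate d q.2 q.1)‖ ^ 2‖) := by
          rw [Real.norm_eq_abs, Real.norm_eq_abs, abs_of_nonneg (sq_nonneg ‖u' (stTranslate d q.2 q.1)‖)]; ring
  exact h.prod_right_ae

/-- Pythagoras for the two projections at the unit direction `ξ̂ = |ξ|⁻¹ξ` (also at `ξ = 0`, where
`ξ̂ = 0`): `‖P_L(ξ̂)w‖² + ‖P_T(ξ̂)w‖² = ‖w‖²` (`|u|² = u_L·u_L + u_T·u_T`). [folklore] -/
theorem norm_projL_sq_add_norm_projT_sq (ξ w : EuclideanSpace ℝ d) :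
    ‖projL (‖ξ‖⁻¹ • ξ) w‖ ^ 2 + ‖projT (‖ξ‖⁻¹ • ξ) w‖ ^ 2 = ‖w‖ ^ 2 := by
  rw [norm_projT_unitDir_sq, projL_apply, norm_smul]
  by_cases hξ : ξ = 0
  · subst hξ
    simp
  · rw [norm_inv_norm_smul hξ, Real.norm_eq_abs, mul_one, sq_abs]
    ring

/-- `P_L(ω)w + P_T(ω)w = w` (`u = u_L + u_T`, Eyink 2003, (u-LT)). [cite: Eyink2003, §2 (u-LT)] -/
theorem projL_add_projT (o w : EuclideanSpace ℝ d) : projL o w + projT o w = w := by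
  rw [projT_apply, projL_apply, add_sub_cancel]

/-- Data of an `L³` velocity on `(0,T) × T^d` in product form: measurability, `∫⁻‖u‖ₑ³ < ∞`,
`∫⁻‖u‖ₑ² < ∞`, `∫⁻‖u‖ₑ < ∞`, and a.e. (on the product) integrability of the slices `u(t)`,
`|u(t)|²`, `|u(t)|²u(t)`. [folklore] -/
theorem velocity_L3_data
    (hum : AEStronglyMeasurable (FunctionSpaces.Torus.stLift u) (volume.restrict (Ioo 0 T ×ˢ univ)))
    (hu3 : ∫⁻ t in Ioo 0 T, ∫⁻ x, ‖u t x‖ₑ ^ 3 < ⊤) :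
    AEStronglyMeasurable (uncurry u) (stMeasure d T) ∧
      (∫⁻ q, ‖uncurry u q‖ₑ ^ (3 : ℝ) ∂(stMeasure d T) < ⊤) ∧
      (∫⁻ q, ‖uncurry u q‖ₑ ^ (2 : ℝ) ∂(stMeasure d T) < ⊤) ∧
      (∫⁻ q, ‖uncurry u q‖ₑ ∂(stMeasure d T) < ⊤) ∧
      (∀ᵐ q ∂(stMeasure d T), MemLp (u q.1) 3 volume) ∧
      (∀ᵐ q ∂(stMeasure d T), Integrable (u q.1) volume) ∧
      (∀ᵐ q ∂(stMeasure d T), Integrable (fun y => ‖u q.1 y‖ ^ 2) volume) ∧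
      (∀ᵐ q ∂(stMeasure d T), Integrable (fun y => ‖u q.1 y‖ ^ 2 • u q.1 y) volume) := by
  set ν := stMeasure d T with hν
  have hu : AEStronglyMeasurable (uncurry u) ν := aestronglyMeasurable_uncurry_prod_of_stLift_Ioo hum
  have hu3' : ∫⁻ q, ‖uncurry u q‖ₑ ^ (3 : ℝ) ∂ν < ⊤ := by
    have h := lintegral_prod_enorm_pow_three_lt_top hu hu3
    have e : ∫⁻ q, ‖uncurry u q‖ₑ ^ 3 ∂ν = ∫⁻ q, ‖uncurry u q‖ₑ ^ (3 : ℝ) ∂ν :=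
      lintegral_congr fun q => ENNReal.pow_three_eq_rpow _
    rw [← e]; exact h
  have hu2 : ∫⁻ q, ‖uncurry u q‖ₑ ^ (2 : ℝ) ∂ν < ⊤ :=
    lintegral_enorm_rpow_lt_top_of_le hu (by norm_num) hu3' (by norm_num) (by norm_num)
  have hu1 : ∫⁻ q, ‖uncurry u q‖ₑ ∂ν < ⊤ := by
    have h := lintegral_enorm_rpow_lt_top_of_le hu (by norm_num) hu3' one_pos (by norm_num : (1 : ℝ) ≤ 3)
    simpa only [ENNReal.rpow_one] using h
  have hL3t : ∀ᵐ t ∂(volume.restrict (Ioo 0 T)), MemLp (u t) 3 volume := ae_memLp_three_of_stLift hum hu3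
  have hL3 : ∀ᵐ q ∂ν, MemLp (u q.1) 3 volume :=
    (Measure.quasiMeasurePreserving_fst (μ := volume.restrict (Ioo 0 T))
      (ν := (volume : Measure (UnitAddTorus d)))).ae hL3t
  refine ⟨hu, hu3', hu2, hu1, hL3, ?_, ?_, ?_⟩
  · exact hL3.mono fun q hq => hq.integrable (by norm_num)
  · exact hL3.mono fun q hq => (memLp_two_iff_integrable_sq_norm hq.1).1 (hq.mono_exponent (by norm_num))
  · filter_upwards [hL3] with q hq
    have h3 : Integrable (fun x => ‖u q.1 x‖ ^ (3 : ℝ)) volume := by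
      simpa [ENNReal.toReal_ofNat] using hq.integrable_norm_rpow three_ne_zero ENNReal.ofNat_ne_top
    refine h3.mono' ((hq.1.norm.pow 2).smul hq.1) (ae_of_all _ fun x => le_of_eq ?_)
    rw [norm_smul, Real.norm_eq_abs, abs_of_nonneg (sq_nonneg _), show (3 : ℝ) = ((3 : ℕ) : ℝ) by norm_num,
      Real.rpow_natCast]
    ring

variable [Nonempty d] [DecidableEq d]

/-- **`u_L^ε + u_T^ε = u^ε = u ⋆ K_ε`** at a.e. `(t,x)` (Eyink 2003, (u-LT)–(moll-u-LT):
`u = u_L + u_T`; the torus convolution with `K_ε = periodize φ^ε` is the Euclidean kernel average,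
`vecConv_mollifierKernel_apply`). [cite: Eyink2003, §2 (moll-u-LT)] -/
theorem ae_eyinkVelocityL_add_eyinkVelocityT
    (hum : AEStronglyMeasurable (FunctionSpaces.Torus.stLift u) (volume.restrict (Ioo 0 T ×ˢ univ)))
    (hu3 : ∫⁻ t in Ioo 0 T, ∫⁻ x, ‖u t x‖ₑ ^ 3 < ⊤)
    (hφ : IsUnitBallMollifier φ) (hε : 0 < ε) :
    ∀ᵐ q ∂(stMeasure d T), eyinkVelocityL φ ε (u q.1) q.2 + eyinkVelocityT φ ε (u q.1) q.2 =
      vecConv (u q.1) (mollifierKernel φ ε) q.2 := by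
  obtain ⟨hu, -, -, hu1, -, hIu, -, -⟩ := velocity_L3_data (T := T) hum hu3
  obtain ⟨hk, -, -, -⟩ := mollifierScale_kernel_facts hφ hε
  have hAL : ∀ ξ v : EuclideanSpace ℝ d, ‖projL (‖ξ‖⁻¹ • ξ) v‖ ≤ 1 * ‖v‖ := fun ξ v => norm_projL_unit_le ξ v
  have hAT : ∀ ξ v : EuclideanSpace ℝ d, ‖projT (‖ξ‖⁻¹ • ξ) v‖ ≤ 2 * ‖v‖ := fun ξ v => norm_projT_unit_le ξ v
  have haeL := ae_inner_integral_kernel_smul_eq (T := T) hk projL hAL continuous_projL hu hu1 (fun _ => 0)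
  have haeT := ae_inner_integral_kernel_smul_eq (T := T) hk projT hAT continuous_projT hu hu1 (fun _ => 0)
  have hbr : ∀ᵐ q ∂(stMeasure d T), vecConv (u q.1) (mollifierKernel φ ε) q.2 =
      ∫ ξ, FluidPDE.mollifierScale ε φ ξ • u q.1 (q.2 + FunctionSpaces.Torus.proj ξ) := by
    filter_upwards [hIu] with q hq
    exact vecConv_mollifierKernel_apply hφ.1 hε hq q.2
  filter_upwards [haeL, haeT, hbr] with q hL hT hq
  have hL' : Integrable (fun ξ : EuclideanSpace ℝ d => FluidPDE.mollifierScale ε φ ξ •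
      projL (‖ξ‖⁻¹ • ξ) (u q.1 (q.2 + FunctionSpaces.Torus.proj ξ))) volume := hL.1
  have hT' : Integrable (fun ξ : EuclideanSpace ℝ d => FluidPDE.mollifierScale ε φ ξ •
      projT (‖ξ‖⁻¹ • ξ) (u q.1 (q.2 + FunctionSpaces.Torus.proj ξ))) volume := hT.1
  rw [hq, (eyink_objectsL_eq φ ε (u q.1) q.2).1, (eyink_objectsT_eq φ ε (u q.1) q.2).1, ← integral_add hL' hT']
  refine integral_congr_ae (ae_of_all _ fun ξ => ?_)
  simp only
  rw [← smul_add, projL_add_projT]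

/-- **`(u_L·u_L)^ε + (u_T·u_T)^ε = (u·u)^ε = |u|² ⋆ K_ε`** at a.e. `(t,x)` (Pythagoras
`|u|² = (ℓ̂·u)² + |u − (ℓ̂·u)ℓ̂|²` under the kernel; `convolution_mollifierKernel_apply`). [cite: Eyink2003, §2 (uuL-eq)–(uuT-eq)] -/
theorem ae_eyinkEnergyL_add_eyinkEnergyT
    (hum : AEStronglyMeasurable (FunctionSpaces.Torus.stLift u) (volume.restrict (Ioo 0 T ×ˢ univ)))
    (hu3 : ∫⁻ t in Ioo 0 T, ∫⁻ x, ‖u t x‖ₑ ^ 3 < ⊤)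
    (hφ : IsUnitBallMollifier φ) (hε : 0 < ε) :
    ∀ᵐ q ∂(stMeasure d T), eyinkEnergyL φ ε (u q.1) q.2 + eyinkEnergyT φ ε (u q.1) q.2 =
      ((fun y => ‖u q.1 y‖ ^ 2) ⋆ mollifierKernel φ ε) q.2 := by
  obtain ⟨hu, -, hu2, -, -, -, hIs, -⟩ := velocity_L3_data (T := T) hum hu3
  obtain ⟨hk, -, -, -⟩ := mollifierScale_kernel_facts hφ hε
  have hAL : ∀ ξ v : EuclideanSpace ℝ d, ‖projL (‖ξ‖⁻¹ • ξ) v‖ ≤ 1 * ‖v‖ := fun ξ v => norm_projL_unit_le ξ v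
  have hAT : ∀ ξ v : EuclideanSpace ℝ d, ‖projT (‖ξ‖⁻¹ • ξ) v‖ ≤ 2 * ‖v‖ := fun ξ v => norm_projT_unit_le ξ v
  have haeL := ae_integrable_kernel_mul_norm_proj_sq (T := T) hk projL hAL continuous_projL hu hu2
  have haeT := ae_integrable_kernel_mul_norm_proj_sq (T := T) hk projT hAT continuous_projT hu hu2
  have hbr : ∀ᵐ q ∂(stMeasure d T), ((fun y => ‖u q.1 y‖ ^ 2) ⋆ mollifierKernel φ ε) q.2 =
      ∫ ξ, FluidPDE.mollifierScale ε φ ξ * ‖u q.1 (q.2 + FunctionSpaces.Torus.proj ξ)‖ ^ 2 := by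
    filter_upwards [hIs] with q hq
    exact convolution_mollifierKernel_apply hφ.1 hε hq q.2
  filter_upwards [haeL, haeT, hbr] with q hL hT hq
  have hL' : Integrable (fun ξ : EuclideanSpace ℝ d => FluidPDE.mollifierScale ε φ ξ *
      ‖projL (‖ξ‖⁻¹ • ξ) (u q.1 (q.2 + FunctionSpaces.Torus.proj ξ))‖ ^ 2) volume := hL
  have hT' : Integrable (fun ξ : EuclideanSpace ℝ d => FluidPDE.mollifierScale ε φ ξ *
      ‖projT (‖ξ‖⁻¹ • ξ) (u q.1 (q.2 + FunctionSpaces.Torus.proj ξ))‖ ^ 2) volume := hT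
  rw [hq, (eyink_objectsL_eq φ ε (u q.1) q.2).2.1, (eyink_objectsT_eq φ ε (u q.1) q.2).2.1, ← integral_add hL' hT']
  refine integral_congr_ae (ae_of_all _ fun ξ => ?_)
  simp only
  rw [← mul_add, norm_projL_sq_add_norm_projT_sq]

/-- **`((u_L·u_L)u)^ε + ((u_T·u_T)u)^ε = (|u|²u)^ε = (|u|²u) ⋆ K_ε`** at a.e. `(t,x)`. [cite: Eyink2003, §2 (uuL-eq)–(uuT-eq)] -/
theorem ae_eyinkEnergyFluxL_add_eyinkEnergyFluxT
    (hum : AEStronglyMeasurable (FunctionSpaces.Torus.stLift u) (volume.restrict (Ioo 0 T ×ˢ univ)))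
    (hu3 : ∫⁻ t in Ioo 0 T, ∫⁻ x, ‖u t x‖ₑ ^ 3 < ⊤)
    (hφ : IsUnitBallMollifier φ) (hε : 0 < ε) :
    ∀ᵐ q ∂(stMeasure d T), eyinkEnergyFluxL φ ε (u q.1) q.2 + eyinkEnergyFluxT φ ε (u q.1) q.2 =
      vecConv (fun y => ‖u q.1 y‖ ^ 2 • u q.1 y) (mollifierKernel φ ε) q.2 := by
  obtain ⟨hu, hu3', -, -, -, -, -, hIw⟩ := velocity_L3_data (T := T) hum hu3
  obtain ⟨hk, -, -, -⟩ := mollifierScale_kernel_facts hφ hε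
  have hAL : ∀ ξ v : EuclideanSpace ℝ d, ‖projL (‖ξ‖⁻¹ • ξ) v‖ ≤ 1 * ‖v‖ := fun ξ v => norm_projL_unit_le ξ v
  have hAT : ∀ ξ v : EuclideanSpace ℝ d, ‖projT (‖ξ‖⁻¹ • ξ) v‖ ≤ 2 * ‖v‖ := fun ξ v => norm_projT_unit_le ξ v
  have haeL := ae_inner_integral_kernel_normSq_smul_eq (T := T) hk projL hAL continuous_projL hu hu3' (fun _ => 0)
  have haeT := ae_inner_integral_kernel_normSq_smul_eq (T := T) hk projT hAT continuous_projT hu hu3' (fun _ => 0)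
  have hbr : ∀ᵐ q ∂(stMeasure d T), vecConv (fun y => ‖u q.1 y‖ ^ 2 • u q.1 y) (mollifierKernel φ ε) q.2 =
      ∫ ξ, FluidPDE.mollifierScale ε φ ξ •
        (‖u q.1 (q.2 + FunctionSpaces.Torus.proj ξ)‖ ^ 2 • u q.1 (q.2 + FunctionSpaces.Torus.proj ξ)) := by
    filter_upwards [hIw] with q hq
    exact vecConv_mollifierKernel_apply hφ.1 hε hq q.2
  filter_upwards [haeL, haeT, hbr] with q hL hT hq
  have hL' : Integrable (fun ξ : EuclideanSpace ℝ d => (FluidPDE.mollifierScale ε φ ξ *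
      ‖projL (‖ξ‖⁻¹ • ξ) (u q.1 (q.2 + FunctionSpaces.Torus.proj ξ))‖ ^ 2) •
        u q.1 (q.2 + FunctionSpaces.Torus.proj ξ)) volume := hL.1
  have hT' : Integrable (fun ξ : EuclideanSpace ℝ d => (FluidPDE.mollifierScale ε φ ξ *
      ‖projT (‖ξ‖⁻¹ • ξ) (u q.1 (q.2 + FunctionSpaces.Torus.proj ξ))‖ ^ 2) •
        u q.1 (q.2 + FunctionSpaces.Torus.proj ξ)) volume := hT.1
  rw [hq, (eyink_objectsL_eq φ ε (u q.1) q.2).2.2, (eyink_objectsT_eq φ ε (u q.1) q.2).2.2, ← integral_add hL' hT']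
  refine integral_congr_ae (ae_of_all _ fun ξ => ?_)
  simp only
  rw [← add_smul, ← mul_add, norm_projL_sq_add_norm_projT_sq, smul_smul]

/-- **`p_L^ε + p_T^ε = p^ε = p ⋆ K_ε`** at a.e. `(t,x)` (`φ_L + φ_T = φ`, Eyink 2003, (phi-LT)–(p-LT);
both kernels `φ_L^ε`, `φ_T^ε` are integrable, so the two `ξ`-integrals converge absolutely at a.e.
`(t,x)` for `p ∈ L^{3/2} ⊂ L¹`). [cite: Eyink2003, §2 (p-LT)] -/
theorem ae_eyinkPressureL_add_eyinkPressureT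
    (hpm : AEStronglyMeasurable (FunctionSpaces.Torus.stLift p) (volume.restrict (Ioo 0 T ×ˢ univ)))
    (hp32 : ∫⁻ t in Ioo 0 T, ∫⁻ x, ‖p t x‖ₑ ^ (3 / 2 : ℝ) < ⊤)
    (hφ : IsUnitBallMollifier φ) (hε : 0 < ε) :
    ∀ᵐ q ∂(stMeasure d T), eyinkPressureL φ ε (p q.1) q.2 + eyinkPressureT φ ε (p q.1) q.2 =
      (p q.1 ⋆ mollifierKernel φ ε) q.2 := by
  set ν := stMeasure d T with hν
  have hp : AEStronglyMeasurable (uncurry p) ν := aestronglyMeasurable_uncurry_prod_of_stLift_Ioo' hpm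
  have hp32' : ∫⁻ q, ‖uncurry p q‖ₑ ^ (3 / 2 : ℝ) ∂ν < ⊤ := by
    have e := lintegral_Ioo_lintegral_eq_lintegral_prod (T := T) (g := fun t x => ‖p t x‖ₑ ^ (3 / 2 : ℝ))
      (hp.enorm.pow_const _)
    rw [e] at hp32
    exact hp32
  have hp1 : ∫⁻ q, ‖uncurry p q‖ₑ ∂ν < ⊤ := by
    have h := lintegral_enorm_rpow_lt_top_of_le hp (by norm_num : (1 : ℝ) ≤ 3 / 2) hp32' one_pos (by norm_num)
    simpa only [ENNReal.rpow_one] using h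
  have hIpt : ∀ᵐ t ∂(volume.restrict (Ioo 0 T)), Integrable (p t) volume := ae_integrable_of_stLift_threeHalves hpm hp32
  have hIp : ∀ᵐ q ∂ν, Integrable (p q.1) volume :=
    (Measure.quasiMeasurePreserving_fst (μ := volume.restrict (Ioo 0 T))
      (ν := (volume : Measure (UnitAddTorus d)))).ae hIpt
  have hd1 : 1 ≤ Fintype.card d := Fintype.card_pos
  obtain ⟨hkL, -, -, -⟩ := longitudinalKernel_scaled_facts hφ hd1 hε
  obtain ⟨hkT, -, -, -⟩ := transverseKernel_scaled_facts hφ hd1 hε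
  have haeL := ae_integrable_kernel_mul_translate_real (T := T) hkL hp hp1
  have haeT := ae_integrable_kernel_mul_translate_real (T := T) hkT hp hp1
  have hbr : ∀ᵐ q ∂ν, (p q.1 ⋆ mollifierKernel φ ε) q.2 =
      ∫ ξ, FluidPDE.mollifierScale ε φ ξ * p q.1 (q.2 + FunctionSpaces.Torus.proj ξ) := by
    filter_upwards [hIp] with q hq
    exact convolution_mollifierKernel_apply hφ.1 hε hq q.2
  filter_upwards [haeL, haeT, hbr] with q hL hT hq
  rw [hq, eyinkPressureL_apply, eyinkPressureT_apply]
  change (∫ ξ, eyinkLongitudinalKernel d (FluidPDE.mollifierScale ε φ) ξ * uncurry p (stTranslate d ξ q)) +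
      (∫ ξ, eyinkTransverseKernel d (FluidPDE.mollifierScale ε φ) ξ * uncurry p (stTranslate d ξ q)) =
    ∫ ξ, FluidPDE.mollifierScale ε φ ξ * uncurry p (stTranslate d ξ q)
  rw [← integral_add hL hT]
  refine integral_congr_ae (ae_of_all _ fun ξ => ?_)
  simp only
  rw [← add_mul, eyinkLongitudinalKernel_add_eyinkTransverseKernel]

end Additivity

/-! ## `𝓔_L + 𝓔_T` as the six scalar Duchon–Robert pairings through `K_ε` -/

section Sum

variable [Nonempty d] [DecidableEq d] {T ε : ℝ} {φ : EuclideanSpace ℝ d → ℝ}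
  {u : ℝ → UnitAddTorus d → EuclideanSpace ℝ d} {p : ℝ → UnitAddTorus d → ℝ} {ψ : ℝ → UnitAddTorus d → ℝ}

omit [Nonempty d] [DecidableEq d] in
/-- Fubini glue: if `l`, `t` are integrable on `(0,T) × T^d` and `l + t = s` a.e., then `s` is
integrable and the iterated integrals add up, `∫₀ᵀ∫ l + ∫₀ᵀ∫ t = ∫₀ᵀ∫ s`. [folklore] -/
theorem integral_integral_add_of_ae_eq {l t s : ℝ × UnitAddTorus d → ℝ} (hl : Integrable l (stMeasure d T))
    (ht : Integrable t (stMeasure d T)) (hs : ∀ᵐ q ∂(stMeasure d T), l q + t q = s q) :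
    Integrable s (stMeasure d T) ∧
      (∫ τ in Ioo 0 T, ∫ x, l (τ, x)) + (∫ τ in Ioo 0 T, ∫ x, t (τ, x)) = ∫ τ in Ioo 0 T, ∫ x, s (τ, x) := by
  have hs' : Integrable s (stMeasure d T) := (hl.add ht).congr (hs.mono fun q hq => hq)
  refine ⟨hs', ?_⟩
  rw [← integral_prod _ hl, ← integral_prod _ ht, ← integral_prod _ hs', ← integral_add hl ht]
  exact integral_congr_ae (hs.mono fun q hq => hq)

omit [DecidableEq d] in
/-- **`𝓔_L^{ε,φ}(ψ)` as the six-term sum**: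
`𝓔_L = 2∫∫⟪u,u_L⟫∂ₜψ + 2∫∫⟪u,u_L⟫⟪u,∇ψ⟫ + ∫∫⟪((u_L·u_L)u)^ε,∇ψ⟫ − ∫∫(u_L·u_L)^ε⟪u,∇ψ⟫ + 2∫∫p⟪u_L,∇ψ⟫ + 2∫∫p_L⟪u,∇ψ⟫`
(each piece integrable on `(0,T) × T^d`, `eyink_piecesL_integrable`; Fubini; the longitudinal twin of
`eyinkBalanceT_eq_sum`). [cite: Eyink2003, §2 (uuL-eq)] -/
theorem eyinkBalanceL_eq_sum
    (hum : AEStronglyMeasurable (FunctionSpaces.Torus.stLift u) (volume.restrict (Ioo 0 T ×ˢ univ)))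
    (hu3 : ∫⁻ t in Ioo 0 T, ∫⁻ x, ‖u t x‖ₑ ^ 3 < ⊤)
    (hpm : AEStronglyMeasurable (FunctionSpaces.Torus.stLift p) (volume.restrict (Ioo 0 T ×ˢ univ)))
    (hp32 : ∫⁻ t in Ioo 0 T, ∫⁻ x, ‖p t x‖ₑ ^ (3 / 2 : ℝ) < ⊤)
    (hφ : IsUnitBallMollifier φ) (hrad : ∀ ξ η : EuclideanSpace ℝ d, ‖ξ‖ = ‖η‖ → φ ξ = φ η) (hε : 0 < ε)
    (hψ : FunctionSpaces.Torus.IsSpaceTimeTestIoo T ψ) :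
    eyinkBalanceL T u p φ ε ψ =
      2 * (∫ t in Ioo 0 T, ∫ x, ⟪u t x, eyinkVelocityL φ ε (u t) x⟫ * FunctionSpaces.Torus.timeDeriv ψ t x) +
      2 * (∫ t in Ioo 0 T, ∫ x,
        ⟪u t x, eyinkVelocityL φ ε (u t) x⟫ * ⟪u t x, FunctionSpaces.Torus.gradient (ψ t) x⟫) +
      (∫ t in Ioo 0 T, ∫ x, ⟪eyinkEnergyFluxL φ ε (u t) x, FunctionSpaces.Torus.gradient (ψ t) x⟫) -
      (∫ t in Ioo 0 T, ∫ x, eyinkEnergyL φ ε (u t) x * ⟪u t x, FunctionSpaces.Torus.gradient (ψ t) x⟫) +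
      2 * (∫ t in Ioo 0 T, ∫ x,
        p t x * ⟪eyinkVelocityL φ ε (u t) x, FunctionSpaces.Torus.gradient (ψ t) x⟫) +
      2 * (∫ t in Ioo 0 T, ∫ x,
        eyinkPressureL φ ε (p t) x * ⟪u t x, FunctionSpaces.Torus.gradient (ψ t) x⟫) := by
  obtain ⟨hA, hB, hC, hD, hE, hF⟩ := eyink_piecesL_integrable hum hu3 hpm hp32 hφ hrad hε hψ
  set ν := stMeasure d T with hν
  -- each iterated integral is a product integral
  rw [← integral_prod _ hA, ← integral_prod _ hB, ← integral_prod _ hC, ← integral_prod _ hD, ← integral_prod _ hE,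
    ← integral_prod _ hF]
  -- the total integrand
  have hTot : Integrable (fun q : ℝ × UnitAddTorus d =>
      2 * (⟪u q.1 q.2, eyinkVelocityL φ ε (u q.1) q.2⟫ * FunctionSpaces.Torus.timeDeriv ψ q.1 q.2) +
      2 * (⟪u q.1 q.2, eyinkVelocityL φ ε (u q.1) q.2⟫ * ⟪u q.1 q.2, FunctionSpaces.Torus.gradient (ψ q.1) q.2⟫) +
      ⟪eyinkEnergyFluxL φ ε (u q.1) q.2, FunctionSpaces.Torus.gradient (ψ q.1) q.2⟫ -
      eyinkEnergyL φ ε (u q.1) q.2 * ⟪u q.1 q.2, FunctionSpaces.Torus.gradient (ψ q.1) q.2⟫ +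
      2 * (p q.1 q.2 * ⟪eyinkVelocityL φ ε (u q.1) q.2, FunctionSpaces.Torus.gradient (ψ q.1) q.2⟫) +
      2 * (eyinkPressureL φ ε (p q.1) q.2 * ⟪u q.1 q.2, FunctionSpaces.Torus.gradient (ψ q.1) q.2⟫)) ν :=
    (((((hA.const_mul 2).add (hB.const_mul 2)).add hC).sub hD).add (hE.const_mul 2)).add (hF.const_mul 2)
  have hBL : eyinkBalanceL T u p φ ε ψ = ∫ q, (
      2 * (⟪u q.1 q.2, eyinkVelocityL φ ε (u q.1) q.2⟫ * FunctionSpaces.Torus.timeDeriv ψ q.1 q.2) +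
      2 * (⟪u q.1 q.2, eyinkVelocityL φ ε (u q.1) q.2⟫ * ⟪u q.1 q.2, FunctionSpaces.Torus.gradient (ψ q.1) q.2⟫) +
      ⟪eyinkEnergyFluxL φ ε (u q.1) q.2, FunctionSpaces.Torus.gradient (ψ q.1) q.2⟫ -
      eyinkEnergyL φ ε (u q.1) q.2 * ⟪u q.1 q.2, FunctionSpaces.Torus.gradient (ψ q.1) q.2⟫ +
      2 * (p q.1 q.2 * ⟪eyinkVelocityL φ ε (u q.1) q.2, FunctionSpaces.Torus.gradient (ψ q.1) q.2⟫) +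
      2 * (eyinkPressureL φ ε (p q.1) q.2 * ⟪u q.1 q.2, FunctionSpaces.Torus.gradient (ψ q.1) q.2⟫)) ∂ν := by
    rw [integral_prod _ hTot, eyinkBalanceL]
    refine setIntegral_congr_fun measurableSet_Ioo fun t _ => ?_
    refine integral_congr_ae (ae_of_all _ fun x => ?_)
    simp only
    ring
  rw [hBL, integral_add, integral_add, integral_sub, integral_add, integral_add, integral_const_mul, integral_const_mul,
    integral_const_mul, integral_const_mul]
  · exact hA.const_mul 2
  · exact hB.const_mul 2
  · exact (hA.const_mul 2).add (hB.const_mul 2)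
  · exact hC
  · exact ((hA.const_mul 2).add (hB.const_mul 2)).add hC
  · exact hD
  · exact (((hA.const_mul 2).add (hB.const_mul 2)).add hC).sub hD
  · exact hE.const_mul 2
  · exact ((((hA.const_mul 2).add (hB.const_mul 2)).add hC).sub hD).add (hE.const_mul 2)
  · exact hF.const_mul 2

/-- **`𝓔_L^{ε,φ}(ψ) + 𝓔_T^{ε,φ}(ψ)` is Duchon–Robert's balance pairing at scale `ε`**: with
`K_ε = periodize φ^ε` (`Torus.mollifierKernel`), `u^ε = u ⋆ K_ε`, `(|u|²)^ε = |u|² ⋆ K_ε`,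
`(|u|²u)^ε = (|u|²u) ⋆ K_ε`, `p^ε = p ⋆ K_ε`,
`𝓔_L + 𝓔_T = 2∫∫⟪u,u^ε⟫∂ₜψ + 2∫∫⟪u,u^ε⟫⟪u,∇ψ⟫ + ∫∫⟪(|u|²u)^ε,∇ψ⟫ − ∫∫(|u|²)^ε⟪u,∇ψ⟫ + 2∫∫p⟪u^ε,∇ψ⟫ + 2∫∫p^ε⟪u,∇ψ⟫`
(term by term: `u_L^ε + u_T^ε = u^ε`, `(u_L·u_L)^ε + (u_T·u_T)^ε = (u·u)^ε`,
`((u_L·u_L)u)^ε + ((u_T·u_T)u)^ε = ((u·u)u)^ε`, `p_L^ε + p_T^ε = p^ε`; Eyink 2003, §2, (u-LT)–(p-LT));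
moreover the two scalar pressure pairings are integrable on `(0,T) × T^d`. [cite: Eyink2003, §2 (uuL-eq)–(uuT-eq)] -/
theorem eyinkBalanceL_add_eyinkBalanceT_eq_sum
    (hum : AEStronglyMeasurable (FunctionSpaces.Torus.stLift u) (volume.restrict (Ioo 0 T ×ˢ univ)))
    (hu3 : ∫⁻ t in Ioo 0 T, ∫⁻ x, ‖u t x‖ₑ ^ 3 < ⊤)
    (hpm : AEStronglyMeasurable (FunctionSpaces.Torus.stLift p) (volume.restrict (Ioo 0 T ×ˢ univ)))
    (hp32 : ∫⁻ t in Ioo 0 T, ∫⁻ x, ‖p t x‖ₑ ^ (3 / 2 : ℝ) < ⊤)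
    (hφ : IsUnitBallMollifier φ) (hrad : ∀ ξ η : EuclideanSpace ℝ d, ‖ξ‖ = ‖η‖ → φ ξ = φ η) (hε : 0 < ε)
    (hψ : FunctionSpaces.Torus.IsSpaceTimeTestIoo T ψ) :
    (eyinkBalanceL T u p φ ε ψ + eyinkBalanceT T u p φ ε ψ =
      2 * (∫ t in Ioo 0 T, ∫ x,
        ⟪u t x, vecConv (u t) (mollifierKernel φ ε) x⟫ * FunctionSpaces.Torus.timeDeriv ψ t x) +
      2 * (∫ t in Ioo 0 T, ∫ x,
        ⟪u t x, vecConv (u t) (mollifierKernel φ ε) x⟫ * ⟪u t x, FunctionSpaces.Torus.gradient (ψ t) x⟫) +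
      (∫ t in Ioo 0 T, ∫ x,
        ⟪vecConv (fun y => ‖u t y‖ ^ 2 • u t y) (mollifierKernel φ ε) x, FunctionSpaces.Torus.gradient (ψ t) x⟫) -
      (∫ t in Ioo 0 T, ∫ x,
        ((fun y => ‖u t y‖ ^ 2) ⋆ mollifierKernel φ ε) x * ⟪u t x, FunctionSpaces.Torus.gradient (ψ t) x⟫) +
      2 * (∫ t in Ioo 0 T, ∫ x,
        p t x * ⟪vecConv (u t) (mollifierKernel φ ε) x, FunctionSpaces.Torus.gradient (ψ t) x⟫) +
      2 * (∫ t in Ioo 0 T, ∫ x,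
        (p t ⋆ mollifierKernel φ ε) x * ⟪u t x, FunctionSpaces.Torus.gradient (ψ t) x⟫)) ∧
    Integrable (fun q : ℝ × UnitAddTorus d =>
      p q.1 q.2 * ⟪vecConv (u q.1) (mollifierKernel φ ε) q.2, FunctionSpaces.Torus.gradient (ψ q.1) q.2⟫) (stMeasure d T) ∧
    Integrable (fun q : ℝ × UnitAddTorus d =>
      (p q.1 ⋆ mollifierKernel φ ε) q.2 * ⟪u q.1 q.2, FunctionSpaces.Torus.gradient (ψ q.1) q.2⟫) (stMeasure d T) := by
  set K := mollifierKernel φ ε with hKdef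
  have hφB : IsRadialBump φ := hφ.1.isRadialBump hrad
  have hφ0 : ∀ ξ, 0 ≤ φ ξ := hφ.1.2.2.2.1
  obtain ⟨hAL, hBL, hCL, hDL, hEL, hFL⟩ := eyink_piecesL_integrable hum hu3 hpm hp32 hφ hrad hε hψ
  obtain ⟨hAT, hBT, hCT, hDT, hET, hFT⟩ := eyink_piecesT_integrable hum hu3 hpm hp32 hφB hφ0 hφ.2 hε hψ
  have hV := ae_eyinkVelocityL_add_eyinkVelocityT (T := T) hum hu3 hφ hε
  have hEn := ae_eyinkEnergyL_add_eyinkEnergyT (T := T) hum hu3 hφ hε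
  have hFl := ae_eyinkEnergyFluxL_add_eyinkEnergyFluxT (T := T) hum hu3 hφ hε
  have hPr := ae_eyinkPressureL_add_eyinkPressureT (T := T) hpm hp32 hφ hε
  rw [← hKdef] at hV hEn hFl hPr
  -- the six term-by-term identities
  obtain ⟨-, eA⟩ := integral_integral_add_of_ae_eq (T := T)
    (s := fun q => ⟪u q.1 q.2, vecConv (u q.1) K q.2⟫ * FunctionSpaces.Torus.timeDeriv ψ q.1 q.2) hAL hAT
    (hV.mono fun q hq => by rw [← hq, inner_add_right, add_mul])
  obtain ⟨-, eB⟩ := integral_integral_add_of_ae_eq (T := T)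
    (s := fun q => ⟪u q.1 q.2, vecConv (u q.1) K q.2⟫ * ⟪u q.1 q.2, FunctionSpaces.Torus.gradient (ψ q.1) q.2⟫) hBL hBT
    (hV.mono fun q hq => by rw [← hq, inner_add_right, add_mul])
  obtain ⟨-, eC⟩ := integral_integral_add_of_ae_eq (T := T)
    (s := fun q => ⟪vecConv (fun y => ‖u q.1 y‖ ^ 2 • u q.1 y) K q.2, FunctionSpaces.Torus.gradient (ψ q.1) q.2⟫) hCL hCT
    (hFl.mono fun q hq => by rw [← hq, inner_add_left])
  obtain ⟨-, eD⟩ := integral_integral_add_of_ae_eq (T := T)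
    (s := fun q => ((fun y => ‖u q.1 y‖ ^ 2) ⋆ K) q.2 * ⟪u q.1 q.2, FunctionSpaces.Torus.gradient (ψ q.1) q.2⟫) hDL hDT
    (hEn.mono fun q hq => by rw [← hq, add_mul])
  obtain ⟨hE, eE⟩ := integral_integral_add_of_ae_eq (T := T)
    (s := fun q => p q.1 q.2 * ⟪vecConv (u q.1) K q.2, FunctionSpaces.Torus.gradient (ψ q.1) q.2⟫) hEL hET
    (hV.mono fun q hq => by rw [← hq, inner_add_left, mul_add])
  obtain ⟨hF, eF⟩ := integral_integral_add_of_ae_eq (T := T)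
    (s := fun q => (p q.1 ⋆ K) q.2 * ⟪u q.1 q.2, FunctionSpaces.Torus.gradient (ψ q.1) q.2⟫) hFL hFT
    (hPr.mono fun q hq => by rw [← hq, add_mul])
  refine ⟨?_, hE, hF⟩
  rw [eyinkBalanceL_eq_sum hum hu3 hpm hp32 hφ hrad hε hψ, eyinkBalanceT_eq_sum hum hu3 hpm hp32 hφB hφ0 hφ.2 hε hψ]
  linear_combination 2 * eA + 2 * eB + eC - eD + 2 * eE + 2 * eF

end Sum

/-! ## Duchon–Robert's balance at scale `ε` through `K_ε`, from the proved scalar facts -/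

section Scalar

variable [DecidableEq d] {T ε : ℝ} {φ : EuclideanSpace ℝ d → ℝ}
  {u : ℝ → UnitAddTorus d → EuclideanSpace ℝ d} {p : ℝ → UnitAddTorus d → ℝ} {ψ : ℝ → UnitAddTorus d → ℝ}

/-- **Duchon–Robert's local balance at scale `ε`, tested against `ψ`** (Duchon–Robert 2000, proof of
Prop. 1, pp. 250–251, inviscid case, in the doubled weak form that matches Eyink's (uuL-eq) + (uuT-eq)):
for a distributional Euler solution `(u,p)` with `u ∈ L³`, `p ∈ L^{3/2}`, a mollifier `φ`, `ε > 0` and a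
test function `ψ` supported in `(0,T)`, with `K = K_ε` the torus kernel of `φ^ε` (`u ⋆ K = u^ε` etc.),
`4∫₀ᵀ∫ D_ε(u)ψ = ∫∫⟪(|u|²u)⋆K,∇ψ⟫ − ∫∫(|u|²⋆K)⟪u,∇ψ⟫ + 2∫∫⟪u,u⋆K⟫⟪u,∇ψ⟫ + 2∫∫⟪u,u⋆K⟫∂ₜψ + 2∫∫p⟪u⋆K,∇ψ⟫ + 2∫∫(p⋆K)⟪u,∇ψ⟫`,
i.e. `2∂ₜ(u·u^ε) + ∇·[2(u·u^ε)u + (|u|²u)^ε − (|u|²)^ε u + 2p^ε u + 2p u^ε] = −4D_ε(u)` in `𝒟'`. Assembled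
from the tree's proved steps exactly as in `Torus.duchon_robert_defect_exists_of`: the cubic identity
`integral_kernelFlux_mul_eq_holds` (`∫∫𝒟_Kψ = A₁ − A₂ + 2A₃ − 2G`), the tested momentum equation
`symmTestField_identity_holds` (`A₅ + G + ∫∫p div Φ = 0`), the pressure split
`integral_mul_divergence_symmTestField` (slice-wise, `∫∫p div Φ = E + F`, given the integrability of the
two pressure pairings on `(0,T) × T^d`) and the unfolding `4D_ε = 𝒟_{K_ε}`
(`four_mul_duchonRobertApprox_eq_kernelFlux`). [cite: DuchonRobert2000, proof of Prop. 1 pp. 250–251] -/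
theorem four_mul_integral_duchonRobertApprox_eq_sum (hsol : IsDistributionalNSSolutionOn T 0 0 u p)
    (hu3 : ∫⁻ t in Ioo 0 T, ∫⁻ x, ‖u t x‖ₑ ^ 3 < ⊤)
    (hp32 : ∫⁻ t in Ioo 0 T, ∫⁻ x, ‖p t x‖ₑ ^ (3 / 2 : ℝ) < ⊤)
    (hφ : FluidPDE.IsMollifier φ) (hε : 0 < ε) (hψ : FunctionSpaces.Torus.IsSpaceTimeTestIoo T ψ)
    (hE : Integrable (fun q : ℝ × UnitAddTorus d =>
      p q.1 q.2 * ⟪vecConv (u q.1) (mollifierKernel φ ε) q.2, FunctionSpaces.Torus.gradient (ψ q.1) q.2⟫) (stMeasure d T))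
    (hF : Integrable (fun q : ℝ × UnitAddTorus d =>
      (p q.1 ⋆ mollifierKernel φ ε) q.2 * ⟪u q.1 q.2, FunctionSpaces.Torus.gradient (ψ q.1) q.2⟫) (stMeasure d T)) :
    4 * (∫ t in Ioo 0 T, ∫ x, duchonRobertApprox φ ε (u t) x * ψ t x) =
      (∫ t in Ioo 0 T, ∫ x,
        ⟪vecConv (fun y => ‖u t y‖ ^ 2 • u t y) (mollifierKernel φ ε) x, FunctionSpaces.Torus.gradient (ψ t) x⟫) -
      (∫ t in Ioo 0 T, ∫ x,
        ((fun y => ‖u t y‖ ^ 2) ⋆ mollifierKernel φ ε) x * ⟪u t x, FunctionSpaces.Torus.gradient (ψ t) x⟫) +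
      2 * (∫ t in Ioo 0 T, ∫ x,
        ⟪u t x, vecConv (u t) (mollifierKernel φ ε) x⟫ * ⟪u t x, FunctionSpaces.Torus.gradient (ψ t) x⟫) +
      2 * (∫ t in Ioo 0 T, ∫ x,
        ⟪u t x, vecConv (u t) (mollifierKernel φ ε) x⟫ * FunctionSpaces.Torus.timeDeriv ψ t x) +
      2 * (∫ t in Ioo 0 T, ∫ x,
        p t x * ⟪vecConv (u t) (mollifierKernel φ ε) x, FunctionSpaces.Torus.gradient (ψ t) x⟫) +
      2 * (∫ t in Ioo 0 T, ∫ x,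
        (p t ⋆ mollifierKernel φ ε) x * ⟪u t x, FunctionSpaces.Torus.gradient (ψ t) x⟫) := by
  set K : UnitAddTorus d → ℝ := mollifierKernel φ ε with hKdef
  have hK : FunctionSpaces.Torus.IsSmooth K := isSmooth_mollifierKernel hφ hε
  have hKev : ∀ z, K (-z) = K z := mollifierKernel_neg hφ ε
  have hdiv : ∀ᵐ t ∂(volume.restrict (Ioo 0 T)), FunctionSpaces.Torus.IsWeaklyDivFree (u t) := hsol.2.2.2.2.1
  have h2 := integral_kernelFlux_mul_eq_holds hsol.1 hu3 hdiv hK hKev hψ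
  have h3 := symmTestField_identity_holds hsol hu3 hp32 hK hKev hψ
  -- slices
  have hL3t : ∀ᵐ t ∂(volume.restrict (Ioo 0 T)), MemLp (u t) 3 volume := ae_memLp_three_of_stLift hsol.1 hu3
  have hIu : ∀ᵐ t ∂(volume.restrict (Ioo 0 T)), Integrable (u t) volume :=
    hL3t.mono fun t ht => ht.integrable (by norm_num)
  have hIp : ∀ᵐ t ∂(volume.restrict (Ioo 0 T)), Integrable (p t) volume :=
    ae_integrable_of_stLift_threeHalves hsol.2.2.1 hp32
  have hψs : ∀ t, FunctionSpaces.Torus.IsSmooth (ψ t) := hψ.isSpaceTimeTest.isSmooth_slice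
  -- `4 D_ε = 𝒟_K` slice-wise
  have h1 : 4 * (∫ t in Ioo 0 T, ∫ x, duchonRobertApprox φ ε (u t) x * ψ t x) =
      ∫ t in Ioo 0 T, ∫ x, kernelFlux K (u t) x * ψ t x := by
    rw [← integral_const_mul]
    refine integral_congr_ae (hL3t.mono fun t ht => ?_)
    dsimp only
    rw [← integral_const_mul]
    refine integral_congr_ae (ae_of_all _ fun x => ?_)
    dsimp only
    rw [← mul_assoc, four_mul_duchonRobertApprox_eq_kernelFlux hφ hε ht x]
  -- the pressure pairing splits
  have h6 : (∫ t in Ioo 0 T, ∫ x, p t x * FunctionSpaces.Torus.divergence (symmTestField K (ψ t) (u t)) x) =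
      (∫ t in Ioo 0 T, ∫ x, p t x * ⟪vecConv (u t) K x, FunctionSpaces.Torus.gradient (ψ t) x⟫) +
        ∫ t in Ioo 0 T, ∫ x, (p t ⋆ K) x * ⟪u t x, FunctionSpaces.Torus.gradient (ψ t) x⟫ := by
    rw [← integral_add hE.integral_prod_left hF.integral_prod_left]
    refine integral_congr_ae ?_
    filter_upwards [hIu, hdiv, hIp] with t hut hdt hpt
    exact integral_mul_divergence_symmTestField hut hdt hpt hK hKev (hψs t)
  rw [zero_mul, add_zero, h6] at h3
  rw [h1, h2]
  linarith

end Scalar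

/-! ## Assembly: the longitudinal balance -/

section Assembly

variable [DecidableEq d] {T : ℝ} {u : ℝ → UnitAddTorus d → EuclideanSpace ℝ d}
  {p : ℝ → UnitAddTorus d → ℝ} {ψ : ℝ → UnitAddTorus d → ℝ} {φ : EuclideanSpace ℝ d → ℝ} {ε : ℝ}

/-- **Eyink's (uuL-eq) at scale `ε` for spherically symmetric unit-ball mollifiers**:
`𝓔_L^{ε,φ}(ψ) = (4/d) ∫₀ᵀ∫ D_L^{ε,φ}(u) ψ`. Proof: `𝓔_L = 4∫∫D_εψ − 𝓔_T`
(`eyinkBalanceL_add_eyinkBalanceT_eq_sum` with `four_mul_integral_duchonRobertApprox_eq_sum`),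
`𝓔_T = (4(d−1)/d)∫∫D_Tψ` (`eyink_transverse_balance_holds`) and
`4∫∫D_εψ = (4/d)∫∫D_Lψ + (4(d−1)/d)∫∫D_Tψ` (`integral_duchonRobertApprox_eq_longitudinal_add_transverse`)
— Eyink 2003, proof of Thm. 1: the `L`- and `T`-computations add up to Duchon–Robert's. [cite: Eyink2003, §2 (uuL-eq)] -/
theorem eyinkBalanceL_eq_of_unitBall (hd : 2 ≤ Fintype.card d)
    (hsol : IsDistributionalNSSolutionOn T 0 0 u p)
    (hu3 : ∫⁻ t in Ioo 0 T, ∫⁻ x, ‖u t x‖ₑ ^ 3 < ⊤)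
    (hp32 : ∫⁻ t in Ioo 0 T, ∫⁻ x, ‖p t x‖ₑ ^ (3 / 2 : ℝ) < ⊤)
    (hφ : IsUnitBallMollifier φ) (hrad : ∀ ξ η : EuclideanSpace ℝ d, ‖ξ‖ = ‖η‖ → φ ξ = φ η) (hε : 0 < ε)
    (hψ : FunctionSpaces.Torus.IsSpaceTimeTestIoo T ψ) :
    eyinkBalanceL T u p φ ε ψ =
      4 / (Fintype.card d : ℝ) * ∫ t in Ioo 0 T, ∫ x, eyinkLongitudinalApprox φ ε (u t) x * ψ t x := by
  haveI : Nonempty d := Fintype.card_pos_iff.1 (by omega)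
  obtain ⟨hsum, hE, hF⟩ := eyinkBalanceL_add_eyinkBalanceT_eq_sum (T := T) hsol.1 hu3 hsol.2.2.1 hp32 hφ hrad hε hψ
  have hS := four_mul_integral_duchonRobertApprox_eq_sum hsol hu3 hp32 hφ.1 hε hψ hE hF
  have hT := eyink_transverse_balance_holds hd hsol hu3 hp32 hφ.1 hrad hε hψ
  have hflux := integral_duchonRobertApprox_eq_longitudinal_add_transverse (T := T) hd hsol.1 hu3 ⟨hφ, hrad⟩ hψ hε
  have hn0 : (Fintype.card d : ℝ) ≠ 0 := by
    have : (2 : ℝ) ≤ Fintype.card d := by exact_mod_cast hd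
    linarith
  have e1 : eyinkBalanceL T u p φ ε ψ =
      4 * (∫ t in Ioo 0 T, ∫ x, duchonRobertApprox φ ε (u t) x * ψ t x) - eyinkBalanceT T u p φ ε ψ := by
    linarith
  rw [e1, hflux, hT]
  field_simp
  ring

/-- **Discharge of the named fact `Torus.eyink_longitudinal_balance`** (`EyinkBalance`; Eyink 2003, §2,
(uuL-eq)), for every spherically symmetric standard mollifier: any support radius is reduced to the
unit ball by rescaling (`φ^ε = (φ_R)^{εR}`, `mollifierScale_mul_mollifierScale_inv`; all objects depend
on `φ` only through `φ^ε`, `eyinkBalanceL_congr_kernel`, `eyinkLongitudinalApprox_congr_kernel`), and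
the unit-ball case is `eyinkBalanceL_eq_of_unitBall`. [cite: Eyink2003, §2 (uuL-eq)] -/
theorem eyink_longitudinal_balance_holds : eyink_longitudinal_balance (d := d) := by
  intro T u p hd hsol hu3 hp φ hφ hrad ε hε ψ hψ
  -- support radius
  obtain ⟨R₀, hR₀⟩ := hφ.2.1.exists_tsupport_subset_closedBall
  set R : ℝ := max R₀ 0 + 1 with hRdef
  have hR : 0 < R := by positivity
  have hsupp : ∀ ξ : EuclideanSpace ℝ d, R < ‖ξ‖ → φ ξ = 0 := by
    intro ξ hξ
    refine image_eq_zero_of_notMem_tsupport fun h => ?_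
    have h' := hR₀ h
    rw [mem_closedBall, dist_zero_right] at h'
    have : R₀ < R := by have := le_max_left R₀ 0; linarith
    linarith
  obtain ⟨hb, hbrad⟩ := isRadialUnitBallMollifier_rescale hφ hrad hR hsupp
  have hk : FluidPDE.mollifierScale (ε * R) (FluidPDE.mollifierScale R⁻¹ φ) = FluidPDE.mollifierScale ε φ :=
    mollifierScale_mul_mollifierScale_inv φ hR ε
  rw [← eyinkBalanceL_congr_kernel hk, ← eyinkLongitudinalApprox_congr_kernel hk]
  exact eyinkBalanceL_eq_of_unitBall hd hsol hu3 hp hb hbrad (mul_pos hε hR) hψ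

end Assembly

end Literature.Analysis.FluidPDE.Torus
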